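import Summits.Langlands.Langlands.Statement
import Literature.NumberTheory.Automorphic.PDAutomorphyLiftingGL2TotallyReal
import HarnessLib

/-!
# `PartialWeightOneLiftingTR` — F3 FLOOR THEOREM / special file (generation 18 on `ReciprocityUpToIrreducibility`,
# item stmt-Langlands-14328; G4 ladder-down, unit fwd2-ladder-Langlands-14328-g18)

The rung family `SingularPlaceLifting s := LiftingOn (· ≤ s)` (dial θ18 = number of SINGULAR = weight-one places above
`p` admitted in PD-crystalline automorphy lifting for `GL₂` over totally real fields; binders verbatim those of the
landed named fact `Literature.NumberTheory.Automorphic.BLGGT2014_thm421_GL2_totallyReal` with the local clause at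
`v ∣ p` dialled: regular crystalline OFF a set `Z` of `≤ s` places, singular-unramified-`p`-distinguished ON `Z`),
the open core `OneSingularPlaceCell := LiftingOn (· = 1)`, THE RUNG `PartialWeightOneLiftingTR := SingularPlaceLifting 1`,
monotonicity `mono`, `rung_of_cells : SingularPlaceLifting 0 → OneSingularPlaceCell → PartialWeightOneLiftingTR`
(PROVED: `#Z ≤ 1 ⇔ #Z = 0 ∨ #Z = 1`), and the FLOOR THEOREM
`floor_zero : BLGGT2014_thm421_GL2_totallyReal → SingularPlaceLifting 0` (PROVED: with `Z = ∅` every `v ∣ p` is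
regular crystalline, the fact's clause verbatim; projection forgets the regular infinity type).  No `sorry`.
-/

noncomputable section

set_option linter.dupNamespace false

open scoped MatrixGroups Matrix NumberField Classical
open NumberField IsDedekindDomain Field Filter
open Literature.NumberTheory.Automorphic Literature.NumberTheory.GaloisRepresentations
open Literature.NumberTheory.PAdicHodge
open Summit.Langlands

namespace Summit.Langlands.Langlands.Cruxes.ReciprocityUpToIrreducibility.PartialWeightOneLiftingTR

/-! ## 1. The local clauses at `v ∣ p` -/

/-- **Regular clause at `v`** (VERBATIM the local clause of `BLGGT2014_thm421_GL2_totallyReal` at one place):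
`ρ|Γ_{F_v}` is CRYSTALLINE for the PINNED Fontaine datum with two DISTINCT `τ`-labelled Hodge–Tate weights for
every `ℚ_p`-label `τ` — the place `v` is REGULAR (classical weight `k_v ≥ 2`). -/
def RegularCrystallineAt {F : Type} [Field F] [NumberField F] (p : ℕ) [Fact p.Prime]
    (ρ : FramedGaloisRep F (PadicAlgCl p) 2) (v : HeightOneSpectrum (𝓞 F))
    (hv : ((p : ℕ) : 𝓞 F) ∈ v.asIdeal) : Prop :=
  let D := fontainePstAdicCompletion v p hv
  D.IsCrystallineFramed (ρ.toLocal v) ∧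
  (letI := D.algebra
   ∀ τ : v.adicCompletion F →ₐ[ℚ_[p]] PadicAlgCl p,
    let M := ρ.labelledHodgeTateWeightsAt v D.algebra D.𝔅 τ.toRingHom
    M.Nodup ∧ Multiset.card M = 2)

/-- **Singular (weight-one) clause at `v`** — the NEW cell of the dial: `ρ|Γ_{F_v}` is de Rham for the pinned
Fontaine datum with `τ`-labelled Hodge–Tate weights `{0,0}` for every label (the ARTIN / WEIGHT-ONE signature,
the per-place conjunct of `IsDeRhamWeightZeroGL2`), UNRAMIFIED at `v`, and residually `p`-DISTINGUISHED at `v`: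
an arithmetic Frobenius at `v` has characteristic polynomial `(X - α)(X - β)` with `α ≢ β (mod 𝔪)` — the
hypotheses of Buzzard–Taylor / Kassaei / Pilloni–Stroh weight-one lifting, asked at ONE place.
[cite: BuzzardTaylor1999, Thm. 1] [cite: Pan2022LocallyAnalytic, Thm. 1.0.5] -/
def SingularUnramifiedAt {F : Type} [Field F] [NumberField F] (p : ℕ) [Fact p.Prime]
    (ρ : FramedGaloisRep F (PadicAlgCl p) 2) (v : HeightOneSpectrum (𝓞 F))
    (hv : ((p : ℕ) : 𝓞 F) ∈ v.asIdeal) : Prop :=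
  let D := fontainePstAdicCompletion v p hv
  D.IsDeRhamFramed (ρ.toLocal v) ∧
  (letI := D.algebra
   ∀ τ : v.adicCompletion F →ₐ[ℚ_[p]] PadicAlgCl p,
    ρ.labelledHodgeTateWeightsAt v D.algebra D.𝔅 τ.toRingHom = {0, 0}) ∧
  ρ.IsUnramifiedAt v ∧
  ∃ α β : PadicAlgCl p,
    ρ.HasFrobCharpolyAt v ((Polynomial.X - Polynomial.C α) * (Polynomial.X - Polynomial.C β)) ∧
    ¬ ‖α - β‖ < 1

/-- `ρ|Γ_{F_v}` is POTENTIALLY DIAGONALIZABLE at every `v ∣ p` (the floor fact's clause, verbatim). -/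
def PotentiallyDiagonalizableAt {F : Type} [Field F] [NumberField F] (p : ℕ) [Fact p.Prime]
    (ρ : FramedGaloisRep F (PadicAlgCl p) 2) : Prop :=
  ∀ (v : HeightOneSpectrum (𝓞 F)) (hv : ((p : ℕ) : 𝓞 F) ∈ v.asIdeal),
    Nonempty (PstCrystallineExtensionData (fontainePstAdicCompletion v p hv)) ∧
    ∀ 𝔈 : PstCrystallineExtensionData (fontainePstAdicCompletion v p hv),
      letI := (fontainePstAdicCompletion v p hv).algebra
      IsPotentiallyDiagonalizable 𝔈.𝔅 (ρ.toLocal v)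

/-- **The Taylor–Wiles hypothesis**: `ρ̄|Γ_{F(ζ_p)}` absolutely irreducible (trace rendering; the fact's clause). -/
def TaylorWilesHypothesis (F : Type) [Field F] [NumberField F] (p : ℕ) [Fact p.Prime]
    (ρ : FramedGaloisRep F (PadicAlgCl p) 2) : Prop :=
  ¬ ∃ χ₁ χ₂ : absoluteGaloisGroup (CyclotomicField p F) →* (PadicAlgCl p)ˣ,
      IsOpen (χ₁.ker : Set (absoluteGaloisGroup (CyclotomicField p F))) ∧
      IsOpen (χ₂.ker : Set (absoluteGaloisGroup (CyclotomicField p F))) ∧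
      ∀ σ, ‖(ρ.restrictField (CyclotomicField p F) σ).val.trace -
        ((χ₁ σ : PadicAlgCl p) + (χ₂ σ : PadicAlgCl p))‖ < 1

/-- **Residually PD-automorphic of level prime to `p`** (the fact's witness clause verbatim): a cuspidal `π₀`,
`L`-algebraic with a REGULAR infinity type, unramified above `p`, attached a.e. to some `ρ₀ ≡ ρ (mod 𝔪)` that is
potentially diagonalizable above `p`. -/
def ResiduallyPDAutomorphic (F : Type) [Field F] [NumberField F] (p : ℕ) [Fact p.Prime]
    (hcpt : isCompact_glFiniteIntegralLevel 2 F) (ι : PadicAlgCl p ≃+* ℂ)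
    (ρ : FramedGaloisRep F (PadicAlgCl p) 2) : Prop :=
  ∃ (π₀ : CuspidalAutomorphicRepData 2 F hcpt) (ρ₀ : FramedGaloisRep F (PadicAlgCl p) 2),
    π₀.1.IsLAlgebraic ∧ (∃ T : InfinityType F 2, π₀.1.HasInfinityType T ∧ T.IsRegular) ∧
    SatakeFrobCompatibleAE ι π₀.1 ρ₀ ∧ (∀ σ, ‖(ρ σ).val.trace - (ρ₀ σ).val.trace‖ < 1) ∧
    (∀ v : HeightOneSpectrum (𝓞 F), ((p : ℕ) : 𝓞 F) ∈ v.asIdeal → π₀.1.IsUnramifiedAt v) ∧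
    ∀ (v : HeightOneSpectrum (𝓞 F)) (hv : ((p : ℕ) : 𝓞 F) ∈ v.asIdeal)
      (𝔈 : PstCrystallineExtensionData (fontainePstAdicCompletion v p hv)),
      letI := (fontainePstAdicCompletion v p hv).algebra
      IsPotentiallyDiagonalizable 𝔈.𝔅 (ρ₀.toLocal v)

/-! ## 2. The family, graded by a condition on the NUMBER of singular places -/

/-- **Lifting with singular signature constrained by `P`.**  For `F` totally real, `p ≥ 7` unramified in `F`,
`ρ : Γ_F → GL₂(ℚ̄_p)` irreducible, a.e. unramified, totally odd, and a finite set `Z` of places ABOVE `p` with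
`P (#Z)`, some place above `p` outside `Z`: REGULAR crystalline (distinct labelled Hodge–Tate weights) at every
`v ∣ p` off `Z`, SINGULAR (de Rham of weights `{0,0}`, unramified, residually `p`-distinguished) at every
`v ∈ Z`, potentially diagonalizable above `p`, Taylor–Wiles hypothesis, residually PD-automorphic ⇒ `ρ` is
automorphic: an `L`-algebraic cuspidal `π` of `GL₂(𝔸_F)` with a.e. Satake–Frobenius compatibility.  The expected
`π` has PARTIAL WEIGHT ONE: weight `1` exactly at (the infinite places paired by `p`-adic labels with) `Z`. -/
def LiftingOn (P : ℕ → Prop) : Prop :=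
  ∀ (F : Type) [Field F] [NumberField F], IsTotallyReal F → ∀ (p : ℕ) [Fact p.Prime], 7 ≤ p →
    ¬ ((p : ℤ) ∣ NumberField.discr F) →
    ∀ (hcpt : isCompact_glFiniteIntegralLevel 2 F) (ι : PadicAlgCl p ≃+* ℂ)
      (ρ : FramedGaloisRep F (PadicAlgCl p) 2) (Z : Finset (HeightOneSpectrum (𝓞 F))),
      P Z.card →
      (∀ v ∈ Z, ((p : ℕ) : 𝓞 F) ∈ v.asIdeal) →
      (∃ w : HeightOneSpectrum (𝓞 F), ((p : ℕ) : 𝓞 F) ∈ w.asIdeal ∧ w ∉ Z) →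
      ρ.toGaloisRep.IsIrreducible →
      (∀ᶠ v : HeightOneSpectrum (𝓞 F) in cofinite, ρ.IsUnramifiedAt v) →
      ρ.IsOdd →
      (∀ (v : HeightOneSpectrum (𝓞 F)) (hv : ((p : ℕ) : 𝓞 F) ∈ v.asIdeal), v ∉ Z →
        RegularCrystallineAt p ρ v hv) →
      (∀ (v : HeightOneSpectrum (𝓞 F)) (hv : ((p : ℕ) : 𝓞 F) ∈ v.asIdeal), v ∈ Z →
        SingularUnramifiedAt p ρ v hv) →
      PotentiallyDiagonalizableAt p ρ →
      TaylorWilesHypothesis F p ρ →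
      ResiduallyPDAutomorphic F p hcpt ι ρ →
      ∃ π : CuspidalAutomorphicRepData 2 F hcpt, π.1.IsLAlgebraic ∧ SatakeFrobCompatibleAE ι π.1 ρ

/-- **The rung family** `E(s)`: at most `s` singular (weight-one) places above `p`.  `E(0)` = the floor
(BLGGT Thm 4.2.1 / Dieulefait–Pacetti Thm 8.11, every place regular); `E(1)` = THE RUNG (one singular place:
PARTIAL WEIGHT ONE lifting, OPEN); `S` sits above every `E(s)`.
[cite: BarnetlambEtAl2014, Thm. 4.2.1] [cite: Stubley2023, §7.3] [cite: GeeKassaei2013, §1] -/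
def SingularPlaceLifting (s : ℕ) : Prop := LiftingOn (· ≤ s)

/-- The floor cell `E(0)`. -/
def RegularEverywhereLifting : Prop := SingularPlaceLifting 0

/-- **The open core**: EXACTLY ONE singular place (and at least one regular place) — partial weight one
automorphy lifting for `GL₂` over totally real fields. -/
def OneSingularPlaceCell : Prop := LiftingOn (· = 1)

/-- **THE RUNG**: at most one singular place. -/
def PartialWeightOneLiftingTR : Prop := SingularPlaceLifting 1

/-! ## 3. Monotonicity, cells, floor -/

/-- Weakening the cardinality condition strengthens the statement. -/
theorem liftingOn_mono {P Q : ℕ → Prop} (hPQ : ∀ m, Q m → P m) (h : LiftingOn P) : LiftingOn Q := by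
  intro F _ _ hF p _ hp hdisc hcpt ι ρ Z hcard hZp hw hirr hunr hodd hreg hsing hpd htw hmod
  exact h F hF p hp hdisc hcpt ι ρ Z (hPQ _ hcard) hZp hw hirr hunr hodd hreg hsing hpd htw hmod

/-- The dial is monotone: more singular places allowed ⇒ stronger statement. -/
theorem mono {s s' : ℕ} (hle : s ≤ s') (h : SingularPlaceLifting s') : SingularPlaceLifting s :=
  liftingOn_mono (fun _ hm => le_trans hm hle) h

/-- The rung implies the floor cell (F3 instantiation direction). -/
@[aesop safe apply]
theorem zeroCell_of_rung (h : PartialWeightOneLiftingTR) : SingularPlaceLifting 0 := mono (by norm_num) h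

/-- The rung implies the open core. -/
theorem oneCell_of_rung (h : PartialWeightOneLiftingTR) : OneSingularPlaceCell :=
  liftingOn_mono (fun _ hm => le_of_eq hm) h

/-- **The rung from its two cells** (PROVED): `#Z ≤ 1 ⇔ #Z = 0 ∨ #Z = 1`. -/
theorem rung_of_cells (h0 : SingularPlaceLifting 0) (h1 : OneSingularPlaceCell) :
    PartialWeightOneLiftingTR := by
  intro F _ _ hF p _ hp hdisc hcpt ι ρ Z hcard hZp hw hirr hunr hodd hreg hsing hpd htw hmod
  rcases Nat.le_one_iff_eq_zero_or_eq_one.mp hcard with hc | hc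
  · exact h0 F hF p hp hdisc hcpt ι ρ Z (le_of_eq hc) hZp hw hirr hunr hodd hreg hsing hpd htw hmod
  · exact h1 F hF p hp hdisc hcpt ι ρ Z hc hZp hw hirr hunr hodd hreg hsing hpd htw hmod

/-- The rung is the conjunction of its cells. -/
theorem rung_iff_cells : PartialWeightOneLiftingTR ↔ SingularPlaceLifting 0 ∧ OneSingularPlaceCell :=
  ⟨fun h => ⟨zeroCell_of_rung h, oneCell_of_rung h⟩, fun h => rung_of_cells h.1 h.2⟩

/-- **FLOOR THEOREM** (F3): BLGGT Thm 4.2.1 (the landed named fact) gives the cell `E(0)`: with no singular place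
every `v ∣ p` is regular crystalline, which is the fact's local clause verbatim; projection forgets the regular
infinity type of `π`.  No `sorry`. -/
theorem floor_zero (h : BLGGT2014_thm421_GL2_totallyReal) : SingularPlaceLifting 0 := by
  intro F _ _ hF p _ hp hdisc hcpt ι ρ Z hcard hZp _hw hirr hunr hodd hreg _hsing hpd htw hmod
  have hZ : Z = ∅ := Finset.card_eq_zero.mp (Nat.le_zero.mp hcard)
  have hcrys : ∀ (v : HeightOneSpectrum (𝓞 F)) (hv : ((p : ℕ) : 𝓞 F) ∈ v.asIdeal),
      RegularCrystallineAt p ρ v hv := fun v hv => hreg v hv (by simp [hZ])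
  obtain ⟨π, hL, -, hS⟩ := h F hF p hp hdisc hcpt ι ρ hirr hunr hodd hcrys hpd htw hmod
  exact ⟨π, hL, hS⟩

/-- F3 instantiation check: the floor IS the family at the dial value `s := 0`. -/
example (h : BLGGT2014_thm421_GL2_totallyReal) : SingularPlaceLifting 0 := by
  simpa using floor_zero h

/-- Given the floor, the rung is EXACTLY the open core. -/
theorem rung_iff_oneCell_of_floor (h : BLGGT2014_thm421_GL2_totallyReal) :
    PartialWeightOneLiftingTR ↔ OneSingularPlaceCell :=
  ⟨oneCell_of_rung, rung_of_cells (floor_zero h)⟩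

end Summit.Langlands.Langlands.Cruxes.ReciprocityUpToIrreducibility.PartialWeightOneLiftingTR

end
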